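import Mathlib

/-!
# Solo-blind kernel #262 — decay bounds for the model function ξ and the explicit outer tail of [A′]

For the decaying root `ξ` of `ξ² + 2wξ − 1 = 0` (the branch with `‖ξ‖ ≤ 1`) we prove the exact identity
`ξ − 1/(2w) = −ξ²/(2w)` and the bounds `‖ξ‖ ≤ 1/‖w‖`, `‖ξ − 1/(2w)‖ ≤ 1/(2‖w‖³)`.  Consequently the explicit part
`k₀/z − A·ξ(z+μ)` of the [A′] remainder on the far line obeys
`‖k₀/z − A ξ‖ ≤ ‖k₀ − A/2‖/‖z‖ + ‖A‖‖μ‖/(2‖z‖‖z+μ‖) + ‖A‖/(2‖z+μ‖³)`,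
which is what the certified assembler integrates beyond the last outer box (ENGINE-L-SPEC §15(k)).
-/

namespace Summit.AnomalousDissipation.SoloBlind.XiDecayBounds

/-- From the quadratic relation, `2wξ = 1 − ξ²`. -/
theorem two_mul_mul_eq {ξ w : ℂ} (h : ξ ^ 2 + 2 * w * ξ - 1 = 0) : 2 * w * ξ = 1 - ξ ^ 2 := by
  linear_combination h

/-- The decaying root expressed through itself: `ξ = (1 − ξ²)/(2w)`. -/
theorem eq_div {ξ w : ℂ} (h : ξ ^ 2 + 2 * w * ξ - 1 = 0) (hw : w ≠ 0) : ξ = (1 - ξ ^ 2) / (2 * w) := by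
  have h2 : (2 : ℂ) * w ≠ 0 := mul_ne_zero two_ne_zero hw
  rw [eq_div_iff h2]
  linear_combination h

/-- Exact identity `ξ − 1/(2w) = −ξ²/(2w)`. -/
theorem sub_half_inv_eq {ξ w : ℂ} (h : ξ ^ 2 + 2 * w * ξ - 1 = 0) (hw : w ≠ 0) :
    ξ - 1 / (2 * w) = -ξ ^ 2 / (2 * w) := by
  have h2 : (2 : ℂ) * w ≠ 0 := mul_ne_zero two_ne_zero hw
  rw [sub_eq_iff_eq_add, ← add_div, eq_div_iff h2]
  linear_combination h

/-- `‖ξ‖ ≤ 1/‖w‖` for the root with `‖ξ‖ ≤ 1`. -/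
theorem norm_le_inv_norm {ξ w : ℂ} (h : ξ ^ 2 + 2 * w * ξ - 1 = 0) (hξ : ‖ξ‖ ≤ 1) (hw : w ≠ 0) :
    ‖ξ‖ ≤ 1 / ‖w‖ := by
  have hwpos : 0 < ‖w‖ := norm_pos_iff.mpr hw
  have key : ξ = (1 - ξ ^ 2) / (2 * w) := eq_div h hw
  have hnum : ‖1 - ξ ^ 2‖ ≤ 2 := by
    calc ‖1 - ξ ^ 2‖ ≤ ‖(1 : ℂ)‖ + ‖ξ ^ 2‖ := norm_sub_le _ _
      _ = 1 + ‖ξ‖ ^ 2 := by rw [norm_one, norm_pow]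
      _ ≤ 1 + 1 := by nlinarith [norm_nonneg ξ]
      _ = 2 := by norm_num
  calc ‖ξ‖ = ‖(1 - ξ ^ 2) / (2 * w)‖ := by rw [← key]
    _ = ‖1 - ξ ^ 2‖ / (2 * ‖w‖) := by rw [norm_div, norm_mul, Complex.norm_ofNat]
    _ ≤ 2 / (2 * ‖w‖) := by gcongr
    _ = 1 / ‖w‖ := by field_simp

/-- `‖ξ − 1/(2w)‖ ≤ 1/(2‖w‖³)`. -/
theorem norm_sub_half_inv_le {ξ w : ℂ} (h : ξ ^ 2 + 2 * w * ξ - 1 = 0) (hξ : ‖ξ‖ ≤ 1) (hw : w ≠ 0) :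
    ‖ξ - 1 / (2 * w)‖ ≤ 1 / (2 * ‖w‖ ^ 3) := by
  have hwpos : 0 < ‖w‖ := norm_pos_iff.mpr hw
  have hb : ‖ξ‖ ≤ 1 / ‖w‖ := norm_le_inv_norm h hξ hw
  rw [sub_half_inv_eq h hw, norm_div, norm_neg, norm_pow, norm_mul, Complex.norm_ofNat]
  have hsq : ‖ξ‖ ^ 2 ≤ (1 / ‖w‖) ^ 2 := by gcongr
  calc ‖ξ‖ ^ 2 / (2 * ‖w‖) ≤ (1 / ‖w‖) ^ 2 / (2 * ‖w‖) := by gcongr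
    _ = 1 / (2 * ‖w‖ ^ 3) := by field_simp

/-- The explicit outer-tail decomposition `k₀/z − Aξ = (k₀ − A/2)/z + (A/2)(1/z − 1/(z+μ)) − A(ξ − 1/(2(z+μ)))`. -/
theorem tail_decomp (k₀ A ξ z μ : ℂ) (hz : z ≠ 0) (hzμ : z + μ ≠ 0) :
    k₀ / z - A * ξ = (k₀ - A / 2) / z + (A / 2) * (μ / (z * (z + μ))) - A * (ξ - 1 / (2 * (z + μ))) := by
  field_simp
  ring

/-- Pointwise bound for the explicit part of the [A′] remainder beyond the last outer box:
`‖k₀/z − Aξ‖ ≤ ‖k₀ − A/2‖/‖z‖ + ‖A‖‖μ‖/(2‖z‖‖z+μ‖) + ‖A‖/(2‖z+μ‖³)` whenever `ξ` is the root of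
`ξ² + 2(z+μ)ξ − 1 = 0` with `‖ξ‖ ≤ 1`. -/
theorem explicit_tail_bound (k₀ A ξ z μ : ℂ) (hz : z ≠ 0) (hzμ : z + μ ≠ 0)
    (h : ξ ^ 2 + 2 * (z + μ) * ξ - 1 = 0) (hξ : ‖ξ‖ ≤ 1) :
    ‖k₀ / z - A * ξ‖ ≤ ‖k₀ - A / 2‖ / ‖z‖ + ‖A‖ * ‖μ‖ / (2 * ‖z‖ * ‖z + μ‖) + ‖A‖ / (2 * ‖z + μ‖ ^ 3) := by
  have hzpos : 0 < ‖z‖ := norm_pos_iff.mpr hz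
  have hzμpos : 0 < ‖z + μ‖ := norm_pos_iff.mpr hzμ
  rw [tail_decomp k₀ A ξ z μ hz hzμ]
  have h1 : ‖(k₀ - A / 2) / z‖ = ‖k₀ - A / 2‖ / ‖z‖ := norm_div _ _
  have h2 : ‖(A / 2) * (μ / (z * (z + μ)))‖ = ‖A‖ * ‖μ‖ / (2 * ‖z‖ * ‖z + μ‖) := by
    rw [norm_mul, norm_div, norm_div, norm_mul, Complex.norm_ofNat]
    field_simp
  have h3 : ‖A * (ξ - 1 / (2 * (z + μ)))‖ ≤ ‖A‖ / (2 * ‖z + μ‖ ^ 3) := by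
    rw [norm_mul]
    have := norm_sub_half_inv_le h hξ hzμ
    calc ‖A‖ * ‖ξ - 1 / (2 * (z + μ))‖ ≤ ‖A‖ * (1 / (2 * ‖z + μ‖ ^ 3)) := by gcongr
      _ = ‖A‖ / (2 * ‖z + μ‖ ^ 3) := by ring
  calc ‖(k₀ - A / 2) / z + (A / 2) * (μ / (z * (z + μ))) - A * (ξ - 1 / (2 * (z + μ)))‖
      ≤ ‖(k₀ - A / 2) / z + (A / 2) * (μ / (z * (z + μ)))‖ + ‖A * (ξ - 1 / (2 * (z + μ)))‖ := norm_sub_le _ _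
    _ ≤ (‖(k₀ - A / 2) / z‖ + ‖(A / 2) * (μ / (z * (z + μ)))‖) + ‖A * (ξ - 1 / (2 * (z + μ)))‖ := by
        gcongr; exact norm_add_le _ _
    _ ≤ ‖k₀ - A / 2‖ / ‖z‖ + ‖A‖ * ‖μ‖ / (2 * ‖z‖ * ‖z + μ‖) + ‖A‖ / (2 * ‖z + μ‖ ^ 3) := by
        rw [h1, h2]; gcongr

end Summit.AnomalousDissipation.SoloBlind.XiDecayBounds
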